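import Literature.NumberTheory.GaloisRepresentations.UniformizerModulus   -- ★ `Ultrametric.measure_preimage_units_smul`, `Ultrametric.distribHaarChar_eq_one_of_norm_eq_one` (modulus of a norm-one unit is `1`)
import Mathlib.MeasureTheory.Integral.Bochner.Basic
import Mathlib.Dynamics.Ergodic.MeasurePreserving
import HarnessLib

/-!
# A RAMIFIED character integrates to zero over every norm-shell of a local field: `∫_{|x| ∈ B} χ(x) dx = 0` (Labesse–Langlands 1979, §2 (2.2))

[LabesseLanglands1979, §2 p. 9, (2.2)]: «Since `∫_{|x| < |ϖ|^N} κ(x) dx = 0`, …» — for the quadratic character `κ` of a RAMIFIED extension (non-trivial on the units)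
the integral of `κ` over any ball around `0` vanishes; this is the step that makes the deep shells of the κ-orbital integral on a ramified elliptic torus
CANCEL (their Lemma 2.1, ramified case).  The mechanism is elementary and place-blind: multiplication by a unit `u` of norm one preserves the additive Haar
measure (its modulus is `1`, [WeilBNT1967, Ch. I §4 Th. 6]) and every set defined through `‖·‖`, while it multiplies `κ` by the constant `κ(u) ≠ 1`; hence
`I = κ(u)·I`, `I = 0`.  No conductor, no residue characteristic, no evaluation of `κ` is needed — the form wanted at the WILDLY ramified places (`v ∣ 2`).

Topic `NumberTheory/LocalFields`; namespace `Literature.NumberTheory.LocalFields.UltrametricCharacterShellIntegral`.  THEOREMS ONLY (no definition, no instance,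
no notation, no named fact, no `sorry`); `K` is ANY nontrivially normed ultrametric field with `ProperSpace K` (every non-archimedean local field), `μ` any additive
Haar measure.  Cell `pub/hodgecm-mathlib` (D-0151), crux H413 = stmt-HodgeConjecture-24833, line «N6nsGerm», residue «R1-CM-ram-wild» (★ def
`RankOneUnstableTransferNonsplitCMERamifiedWild`); LEAD F0P3a-plan (g10) WORD T9-22 (4) «(W′4) deep shells cancel → A-p12»; census `CENSUS-R1LL-wild.A-p12g19.md`
822e2006 §2 (W′4).  Hand A-p12 (g19).

* §1 (any measure space) `integral_eq_zero_of_measurePreserving_of_comp_eq_mul` — `T` measure-preserving measurable embedding, `f ∘ T = c·f`, `c ≠ 1` ⇒ `∫ f = 0`;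
  `setIntegral_eq_zero_of_measurePreserving_of_comp_eq_mul` — the same on a `T`-stable measurable set.
* §2 (ultrametric `K`) `map_units_mul_eq_self_of_norm_eq_one`, `measurePreserving_units_mul_of_norm_eq_one` — `x ↦ u·x` preserves `μ` when `‖u‖ = 1`.
* §3 **`setIntegral_norm_preimage_eq_zero`** — for `χ : K →*₀ ℂ` and a unit `u`, `‖u‖ = 1`, `χ u ≠ 1`: `∫ x in ‖·‖⁻¹(B), χ x ∂μ = 0` for every measurable `B ⊆ ℝ`;
  corollaries on `ball 0 r`, `closedBall 0 r`, `sphere 0 r` ((2.2) verbatim is the `ball` case).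
HONEST LABEL: HC_CM is proved only modulo the printed citations (2 remaining named inputs hLiu418, h413) until rung 0 closes; this file is unconditional measure theory.

## References
* [LabesseLanglands1979] J.-P. Labesse, R. P. Langlands, *L-indistinguishability for SL(2)*, Canad. J. Math. 31 (1979): §2, Lemma 2.1 and (2.2) p. 9.
* [WeilBNT1967] A. Weil, *Basic Number Theory* (1967): Ch. I §4 Th. 6 (the modulus of an automorphism; `mod(u) = 1` on units), Ch. I §2.
* [TateThesis1967] J. Tate, *Fourier analysis in number fields and Hecke's zeta-functions* (1967): §2.3 (integrals of ramified quasi-characters over `𝒪^×` vanish).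
-/

set_option autoImplicit false

noncomputable section

open MeasureTheory Measure Set Metric
open scoped ENNReal NNReal

namespace Literature.NumberTheory.LocalFields.UltrametricCharacterShellIntegral

/-! ## §1 An eigenfunction of a measure-preserving map with eigenvalue `≠ 1` integrates to zero -/

section Generic

variable {X : Type*} [MeasurableSpace X] {μ : Measure X} {T : X → X}

/-- **`∫ f dμ = 0` if `f ∘ T = c·f` with `c ≠ 1` for a `μ`-preserving measurable embedding `T`**: `∫ f = ∫ f ∘ T = c ∫ f`.  (No integrability needed: a
non-integrable `f` has integral `0` by convention on both sides.) [cite: WeilBNT1967, Ch. I §2] -/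
theorem integral_eq_zero_of_measurePreserving_of_comp_eq_mul (hT : MeasurePreserving T μ μ) (hTe : MeasurableEmbedding T)
    {f : X → ℂ} {c : ℂ} (hf : ∀ x, f (T x) = c * f x) (hc : c ≠ 1) : ∫ x, f x ∂μ = 0 := by
  have h1 : ∫ x, f x ∂μ = c * ∫ x, f x ∂μ := by
    calc ∫ x, f x ∂μ = ∫ x, f (T x) ∂μ := (hT.integral_comp hTe f).symm
      _ = ∫ x, c * f x ∂μ := by simp_rw [hf]
      _ = c * ∫ x, f x ∂μ := integral_const_mul c f
  have h2 : (1 - c) * ∫ x, f x ∂μ = 0 := by rw [sub_mul, one_mul, ← h1, sub_self]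
  rcases mul_eq_zero.1 h2 with h | h
  · exact absurd (sub_eq_zero.1 h).symm hc
  · exact h

/-- **The same on a `T`-stable measurable set `S`** (`T ⁻¹' S = S`): `∫_S f dμ = 0`. [cite: WeilBNT1967, Ch. I §2] -/
theorem setIntegral_eq_zero_of_measurePreserving_of_comp_eq_mul (hT : MeasurePreserving T μ μ) (hTe : MeasurableEmbedding T)
    {S : Set X} (hS : MeasurableSet S) (hTS : T ⁻¹' S = S)
    {f : X → ℂ} {c : ℂ} (hf : ∀ x, f (T x) = c * f x) (hc : c ≠ 1) : ∫ x in S, f x ∂μ = 0 := by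
  have hT' : MeasurePreserving T (μ.restrict S) (μ.restrict S) := by
    have h := hT.restrict_preimage hS
    rwa [hTS] at h
  exact integral_eq_zero_of_measurePreserving_of_comp_eq_mul hT' hTe hf hc

end Generic

/-! ## §2 Multiplication by a norm-one unit preserves the additive Haar measure of an ultrametric field -/

section Ultrametric

open Literature.NumberTheory.GaloisRepresentations.Ultrametric

variable {K : Type*} [NontriviallyNormedField K] [IsUltrametricDist K] [ProperSpace K] [MeasurableSpace K] [BorelSpace K]
  (μ : Measure K) [IsAddHaarMeasure μ]

/-- **`(u·)_* μ = μ` for a unit of norm one**: the modulus of `x ↦ u x` is `mod_K(u⁻¹) = 1` (★ `measure_preimage_units_smul`,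
★ `distribHaarChar_eq_one_of_norm_eq_one`). [cite: WeilBNT1967, Ch. I §4 Th. 6] -/
theorem map_units_mul_eq_self_of_norm_eq_one (u : Kˣ) (hu : ‖(u : K)‖ = 1) : μ.map (fun x : K => (u : K) * x) = μ := by
  have hu' : ‖((u⁻¹ : Kˣ) : K)‖ = 1 := by
    rw [Units.val_inv_eq_inv_val, norm_inv, hu, inv_one]
  refine Measure.ext fun s hs => ?_
  rw [Measure.map_apply (measurable_const_mul (u : K)) hs]
  have h := measure_preimage_units_smul μ u s
  have hsmul : (fun x : K => u • x) = fun x : K => (u : K) * x := by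
    funext x; rfl
  rw [hsmul] at h
  rw [h, distribHaarChar_eq_one_of_norm_eq_one u⁻¹ hu', ENNReal.coe_one, one_mul]

/-- **Multiplication by a norm-one unit is measure preserving** for every additive Haar measure. [cite: WeilBNT1967, Ch. I §4 Th. 6] -/
theorem measurePreserving_units_mul_of_norm_eq_one (u : Kˣ) (hu : ‖(u : K)‖ = 1) :
    MeasurePreserving (fun x : K => (u : K) * x) μ μ :=
  ⟨measurable_const_mul (u : K), map_units_mul_eq_self_of_norm_eq_one μ u hu⟩

omit [IsUltrametricDist K] [ProperSpace K] in
/-- Multiplication by a unit is a measurable embedding (a homeomorphism of `K`). [folklore] -/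
private theorem measurableEmbedding_units_mul (u : Kˣ) : MeasurableEmbedding fun x : K => (u : K) * x :=
  (Homeomorph.mulLeft₀ (u : K) u.ne_zero).measurableEmbedding

omit [IsUltrametricDist K] [ProperSpace K] [MeasurableSpace K] [BorelSpace K] in
/-- A norm-shell `‖·‖⁻¹(B)` is stable under multiplication by a norm-one unit. [folklore] -/
private theorem preimage_units_mul_norm_preimage (u : Kˣ) (hu : ‖(u : K)‖ = 1) (B : Set ℝ) :
    (fun x : K => (u : K) * x) ⁻¹' ((fun x : K => ‖x‖) ⁻¹' B) = (fun x : K => ‖x‖) ⁻¹' B := by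
  ext x
  simp only [Set.mem_preimage, norm_mul, hu, one_mul]

/-! ## §3 A ramified character integrates to zero over every norm-shell -/

/-- **LABESSE–LANGLANDS (2.2), SHELL FORM.**  For a multiplicative character `χ : K →*₀ ℂ` which is RAMIFIED — non-trivial on some unit `u` of norm one — and every
measurable `B ⊆ ℝ`: **`∫ x in {x | ‖x‖ ∈ B}, χ x ∂μ = 0`** (the shell is `u`-stable, `μ` is `u`-invariant, and `χ(u x) = χ(u) χ(x)` with `χ(u) ≠ 1`).
[cite: LabesseLanglands1979, §2 (2.2) p. 9] [cite: TateThesis1967, §2.3] -/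
theorem setIntegral_norm_preimage_eq_zero (χ : K →*₀ ℂ) (u : Kˣ) (hu : ‖(u : K)‖ = 1) (hχu : χ (u : K) ≠ 1)
    (B : Set ℝ) (hB : MeasurableSet B) :
    ∫ x in (fun x : K => ‖x‖) ⁻¹' B, χ x ∂μ = 0 :=
  setIntegral_eq_zero_of_measurePreserving_of_comp_eq_mul (measurePreserving_units_mul_of_norm_eq_one μ u hu) (measurableEmbedding_units_mul u)
    (measurable_norm hB) (preimage_units_mul_norm_preimage u hu B) (fun x => by rw [map_mul]) hχu

/-- **(2.2) verbatim — the OPEN BALL**: `∫_{‖x‖ < r} χ(x) dμ = 0` for a ramified `χ`. [cite: LabesseLanglands1979, §2 (2.2) p. 9] -/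
theorem integral_ball_eq_zero (χ : K →*₀ ℂ) (u : Kˣ) (hu : ‖(u : K)‖ = 1) (hχu : χ (u : K) ≠ 1) (r : ℝ) :
    ∫ x in ball (0 : K) r, χ x ∂μ = 0 := by
  have h : ball (0 : K) r = (fun x : K => ‖x‖) ⁻¹' Set.Iio r := by
    ext x; simp [Metric.mem_ball, dist_zero_right]
  rw [h]
  exact setIntegral_norm_preimage_eq_zero μ χ u hu hχu _ measurableSet_Iio

/-- **The CLOSED BALL**: `∫_{‖x‖ ≤ r} χ(x) dμ = 0` for a ramified `χ`. [cite: LabesseLanglands1979, §2 (2.2) p. 9] -/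
theorem integral_closedBall_eq_zero (χ : K →*₀ ℂ) (u : Kˣ) (hu : ‖(u : K)‖ = 1) (hχu : χ (u : K) ≠ 1) (r : ℝ) :
    ∫ x in closedBall (0 : K) r, χ x ∂μ = 0 := by
  have h : closedBall (0 : K) r = (fun x : K => ‖x‖) ⁻¹' Set.Iic r := by
    ext x; simp [Metric.mem_closedBall, dist_zero_right]
  rw [h]
  exact setIntegral_norm_preimage_eq_zero μ χ u hu hχu _ measurableSet_Iic

/-- **ONE SHELL**: `∫_{‖x‖ = r} χ(x) dμ = 0` for a ramified `χ` (the shells `|x| = |ϖ|^m` of the κ-orbital integral cancel one by one). [cite: LabesseLanglands1979, §2 (2.1)–(2.2) pp. 8–9] -/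
theorem integral_sphere_eq_zero (χ : K →*₀ ℂ) (u : Kˣ) (hu : ‖(u : K)‖ = 1) (hχu : χ (u : K) ≠ 1) (r : ℝ) :
    ∫ x in sphere (0 : K) r, χ x ∂μ = 0 := by
  have h : sphere (0 : K) r = (fun x : K => ‖x‖) ⁻¹' {r} := by
    ext x; simp
  rw [h]
  exact setIntegral_norm_preimage_eq_zero μ χ u hu hχu _ (measurableSet_singleton r)

/-- **WEIGHTED SHELL FORM**: for any function `g : K → ℂ` that factors through the norm (`g x = G ‖x‖` — a radial weight, e.g. the orbital-integral weight
`|x|·f(…)` of (2.1) once the window has stabilised) and a ramified `χ`: `∫ x in ‖·‖⁻¹(B), g x * χ x ∂μ = 0`. [cite: LabesseLanglands1979, §2 (2.1)–(2.2) pp. 8–9] -/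
theorem setIntegral_radial_mul_eq_zero (χ : K →*₀ ℂ) (u : Kˣ) (hu : ‖(u : K)‖ = 1) (hχu : χ (u : K) ≠ 1)
    (G : ℝ → ℂ) (B : Set ℝ) (hB : MeasurableSet B) :
    ∫ x in (fun x : K => ‖x‖) ⁻¹' B, G ‖x‖ * χ x ∂μ = 0 :=
  setIntegral_eq_zero_of_measurePreserving_of_comp_eq_mul (measurePreserving_units_mul_of_norm_eq_one μ u hu) (measurableEmbedding_units_mul u)
    (measurable_norm hB) (preimage_units_mul_norm_preimage u hu B)
    (c := χ (u : K)) (fun x => by rw [map_mul, norm_mul, hu, one_mul]; ring) hχu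

end Ultrametric

end Literature.NumberTheory.LocalFields.UltrametricCharacterShellIntegral

end
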